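import Summits.QuantumFields.YangMills.Theorems.LuscherReductionRunningReductionCoarseUpperCopies
import HarnessLib

/-!
# Admissible IMS scales exist: `δ = η = β^{−p}`, `0 < p < 1/3` (fixed-lattice programme COARSE(L₀) — route `LuscherReduction`, crux RED
# stmt-QuantumFields-19978 KT-door 3b′ / crux `TwistedTraceScaling` stmt-QuantumFields-20203 S-BASE; design note
# `pub/ym-fleet/ym-luscher-20007-p1/COARSE-DESIGN.md` §9)

The glue `coarseNoIntruderAt_of_valley_inner` (`…CoarseUpperGlue`) and the eight-copies reduction `innerNoIntruderAt_of_oneOrbit` (`…CoarseUpperCopies`)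
are stated for abstract scale functions `δ, η : ℝ → ℝ` under `ScalesAdmissible L δ η` (onion error `= o(λ_b) · uniformFloorConst`) and
`eventually δ β ≤ 1/(2L)`.  This file discharges both side conditions for the polynomial scales
`powScale p β = (max β 1)^{−p}` with `0 < p < 1/3`:
* `powScale_pos`, `powScale_eq` (`= β^{−p}` for `β ≥ 1`), `powScale_eventually_le` (`→ 0`);
* `onionErr_rpow_le` — for `β ≥ 1`: `onionErr L β β^{−p} β^{−p} ≤ β^{p−1} + A_L β^{2p−1}`, `A_L = (3|E|²/2)(64π² + 16π²|P|²)` (`e^{−x} ≤ 1/x`);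
* `bareLambda_cube_eq` — `λ_b(L³β) = (2/L³)^{1/3} β^{−1/3}`;
* ★ `scalesAdmissible_powScale : 0 < p → p < 1/3 → ScalesAdmissible L (powScale p) (powScale p)` (both exponents `p − 1`, `2p − 1` are `< −1/3`);
* ★ `coarseNoIntruderAt_of_valley_oneOrbit_pow` — COARSE-UPPER(L) from `ValleyGainAt L (powScale p) (powScale p)` and
  `InnerNoIntruderOneOrbitAt L (powScale p)` alone, for any `0 < p < 1/3`.
So the hypothesis set of the COARSE-UPPER reduction is consistent in its scale component; what remains OPEN is exactly V(L) and I₁(L) at `β^{−p}`.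
HONEST FRAMING: real-analysis bookkeeping; femto rung R2b1; not infinite volume, not a gap, not Clay.
-/

set_option autoImplicit false

noncomputable section

open MeasureTheory Filter Topology Real
open scoped BigOperators
open Literature.MathematicalPhysics.QuantumFieldTheory
open Literature.MathematicalPhysics.QuantumLattice

namespace Summit.QuantumFields.YangMills.Theorems.FemtoTransferGap

variable {L : ℕ} [NeZero L]

/-! ## §1 Polynomial scales -/

/-- **Polynomial IMS scale** `powScale p β = (max β 1)^{−p}` (`= β^{−p}` for `β ≥ 1`; positive for every real `β`). [folklore] -/
def powScale (p : ℝ) (β : ℝ) : ℝ := (max β 1) ^ (-p)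

/-- `0 < powScale p β`. [folklore] -/
theorem powScale_pos (p β : ℝ) : 0 < powScale p β := by
  unfold powScale
  exact Real.rpow_pos_of_pos (lt_of_lt_of_le one_pos (le_max_right _ _)) _

/-- For `β ≥ 1`: `powScale p β = β^{−p}`. [folklore] -/
theorem powScale_eq {p β : ℝ} (hβ : 1 ≤ β) : powScale p β = β ^ (-p) := by
  unfold powScale; rw [max_eq_left hβ]

/-- Negative powers are eventually small: `∃ β0, ∀ β ≥ β0, 1 ≤ β ∧ β^{−q} ≤ M` (`q, M > 0`). [folklore] -/
theorem rpow_neg_eventually_le {q M : ℝ} (hq : 0 < q) (hM : 0 < M) : ∃ β0 : ℝ, ∀ β : ℝ, β0 ≤ β → 1 ≤ β ∧ β ^ (-q) ≤ M := by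
  refine ⟨max 1 ((1 / M) ^ q⁻¹), fun β hβ => ?_⟩
  have hβ1 : 1 ≤ β := (le_max_left _ _).trans hβ
  have hβ0 : 0 < β := by linarith
  refine ⟨hβ1, ?_⟩
  have hb : (1 / M) ^ q⁻¹ ≤ β := (le_max_right _ _).trans hβ
  have h1 : ((1 / M) ^ q⁻¹) ^ q ≤ β ^ q := Real.rpow_le_rpow (by positivity) hb hq.le
  rw [Real.rpow_inv_rpow (by positivity) hq.ne'] at h1
  rw [Real.rpow_neg hβ0.le]
  have hβq : 0 < β ^ q := Real.rpow_pos_of_pos hβ0 q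
  rw [inv_le_comm₀ hβq hM]
  calc M⁻¹ = 1 / M := (one_div M).symm
    _ ≤ β ^ q := h1

/-- `powScale p β ≤ c` eventually, for every `c > 0` (`p > 0`). [folklore] -/
theorem powScale_eventually_le {p : ℝ} (hp : 0 < p) {c : ℝ} (hc : 0 < c) : ∃ β0 : ℝ, ∀ β : ℝ, β0 ≤ β → powScale p β ≤ c := by
  obtain ⟨β0, h⟩ := rpow_neg_eventually_le hp hc
  refine ⟨β0, fun β hβ => ?_⟩
  obtain ⟨hβ1, hle⟩ := h β hβ
  rw [powScale_eq hβ1]; exact hle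

/-! ## §2 The onion error at polynomial scales -/

variable (L) in
/-- The IMS constant `A_L = (3|E|²/2)·(64π² + 16π²|P|²)`. [folklore] -/
def imsConst : ℝ := 3 * (Fintype.card (Edge 3 L) : ℝ) ^ 2 / 2 * (64 * π ^ 2 + 16 * π ^ 2 * (Fintype.card (Plaquette 3 L) : ℝ) ^ 2)

/-- `0 ≤ A_L`. [folklore] -/
theorem imsConst_nonneg : 0 ≤ imsConst L := by unfold imsConst; positivity

/-- ★ **Onion error at `δ = η = β^{−p}`** (`β ≥ 1`): `onionErr L β β^{−p} β^{−p} ≤ β^{p−1} + A_L·β^{2p−1}`. [folklore] -/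
theorem onionErr_rpow_le {p β : ℝ} (hβ : 1 ≤ β) :
    onionErr L β (β ^ (-p)) (β ^ (-p)) ≤ β ^ (p - 1) + imsConst L * β ^ (2 * p - 1) := by
  have hβ0 : 0 < β := by linarith
  have hd : 0 < β ^ (-p) := Real.rpow_pos_of_pos hβ0 _
  -- the large-field term
  have h1 : Real.exp (-(β * β ^ (-p))) ≤ β ^ (p - 1) := by
    have e : β * β ^ (-p) = β ^ (1 - p) := by
      rw [show (1 : ℝ) - p = 1 + -p by ring, Real.rpow_add hβ0, Real.rpow_one]
    rw [e]
    -- `e^{−x} ≤ x⁻¹` for `x = β^{1−p} > 0` (the tree's `Hamburger1921.exp_neg_le_inv`, inlined to keep the import cone small)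
    have hx : 0 < β ^ (1 - p) := Real.rpow_pos_of_pos hβ0 _
    have hexp : Real.exp (-(β ^ (1 - p))) ≤ (β ^ (1 - p))⁻¹ := by
      have h := Real.add_one_le_exp (β ^ (1 - p))
      rw [Real.exp_neg, inv_le_inv₀ (Real.exp_pos _) hx]
      linarith
    refine hexp.trans (le_of_eq ?_)
    rw [← Real.rpow_neg hβ0.le, show -(1 - p) = p - 1 by ring]
  -- the IMS terms
  have hinv : (β ^ (-p))⁻¹ = β ^ p := by rw [Real.rpow_neg hβ0.le, inv_inv]
  have h2 : (1 / 2) * ((Fintype.card (Edge 3 L) : ℝ) ^ 2 * (3 / β) *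
      ((8 * π / β ^ (-p)) ^ 2 + (4 * π * Fintype.card (Plaquette 3 L) / β ^ (-p)) ^ 2)) = imsConst L * β ^ (2 * p - 1) := by
    have e2 : β ^ (2 * p - 1) = (β ^ p) ^ 2 / β := by
      rw [Real.rpow_sub_one hβ0.ne', show 2 * p = p * 2 by ring, Real.rpow_mul hβ0.le, Real.rpow_two]
    rw [e2, div_eq_mul_inv (8 * π), div_eq_mul_inv (4 * π * _), hinv]
    unfold imsConst
    field_simp
    ring
  unfold onionErr
  rw [h2]
  linarith

/-! ## §3 `λ_b(L³β)` as a power of `β` -/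

/-- `λ_b(L³β) = (2/L³)^{1/3} · β^{−1/3}` (`β > 0`). [folklore] -/
theorem bareLambda_cube_eq {β : ℝ} (hβ : 0 < β) :
    bareLambda ((L : ℝ) ^ 3 * β) = (2 / (L : ℝ) ^ 3) ^ ((1 : ℝ) / 3) * β ^ (-(1 : ℝ) / 3) := by
  have hL : (0 : ℝ) < (L : ℝ) ^ 3 := by
    have : (0 : ℝ) < L := by exact_mod_cast Nat.pos_of_ne_zero (NeZero.ne L)
    positivity
  unfold bareLambda
  rw [show (2 : ℝ) / ((L : ℝ) ^ 3 * β) = 2 / (L : ℝ) ^ 3 * β⁻¹ by field_simp, Real.mul_rpow (by positivity) (by positivity),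
    Real.inv_rpow hβ.le, ← Real.rpow_neg hβ.le]
  congr 1
  norm_num

/-! ## §4 Admissibility -/

/-- ★★ **Polynomial scales are admissible**: `ScalesAdmissible L (powScale p) (powScale p)` for `0 < p < 1/3`. [folklore] -/
theorem scalesAdmissible_powScale {p : ℝ} (hp0 : 0 < p) (hp : p < 1 / 3) : ScalesAdmissible L (powScale p) (powScale p) := by
  refine ⟨fun β => powScale_pos p β, fun β => powScale_pos p β, fun κ hκ => ?_⟩
  have hL : (0 : ℝ) < (L : ℝ) ^ 3 := by
    have : (0 : ℝ) < L := by exact_mod_cast Nat.pos_of_ne_zero (NeZero.ne L)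
    positivity
  have hcL := uniformFloorConst_pos (L := L)
  set κ' : ℝ := κ * (2 / (L : ℝ) ^ 3) ^ ((1 : ℝ) / 3) * uniformFloorConst L with hκ'
  have hκ'0 : 0 < κ' := by rw [hκ']; positivity
  -- exponents
  have hq1 : 0 < 2 / 3 - p := by linarith
  have hq2 : 0 < 2 / 3 - 2 * p := by linarith
  obtain ⟨β1, h1⟩ := rpow_neg_eventually_le hq1 (half_pos hκ'0)
  obtain ⟨β2, h2⟩ := rpow_neg_eventually_le hq2 (M := κ' / 2 / (imsConst L + 1)) (by positivity [imsConst_nonneg (L := L)])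
  refine ⟨max β1 β2, fun β hβ => ?_⟩
  obtain ⟨hβ1, hA⟩ := h1 β ((le_max_left _ _).trans hβ)
  obtain ⟨-, hB⟩ := h2 β ((le_max_right _ _).trans hβ)
  have hβ0 : 0 < β := by linarith
  rw [powScale_eq hβ1]
  refine (onionErr_rpow_le (L := L) hβ1).trans ?_
  rw [bareLambda_cube_eq (L := L) hβ0]
  -- `β^{p−1} = β^{−(2/3−p)} β^{−1/3}`, `β^{2p−1} = β^{−(2/3−2p)} β^{−1/3}`
  have e1 : β ^ (p - 1) = β ^ (-(2 / 3 - p)) * β ^ (-(1 : ℝ) / 3) := by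
    rw [← Real.rpow_add hβ0]; congr 1; ring
  have e2 : β ^ (2 * p - 1) = β ^ (-(2 / 3 - 2 * p)) * β ^ (-(1 : ℝ) / 3) := by
    rw [← Real.rpow_add hβ0]; congr 1; ring
  rw [e1, e2]
  have hb3 : 0 < β ^ (-(1 : ℝ) / 3) := Real.rpow_pos_of_pos hβ0 _
  have hA' : β ^ (-(2 / 3 - p)) * β ^ (-(1 : ℝ) / 3) ≤ κ' / 2 * β ^ (-(1 : ℝ) / 3) := mul_le_mul_of_nonneg_right hA hb3.le
  have hB' : imsConst L * (β ^ (-(2 / 3 - 2 * p)) * β ^ (-(1 : ℝ) / 3)) ≤ κ' / 2 * β ^ (-(1 : ℝ) / 3) := by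
    have hI := imsConst_nonneg (L := L)
    have h3 : imsConst L * β ^ (-(2 / 3 - 2 * p)) ≤ imsConst L * (κ' / 2 / (imsConst L + 1)) := mul_le_mul_of_nonneg_left hB hI
    have h4 : imsConst L * (κ' / 2 / (imsConst L + 1)) ≤ κ' / 2 := by
      rw [mul_div_assoc', div_le_iff₀ (by positivity)]; nlinarith
    have := mul_le_mul_of_nonneg_right (h3.trans h4) hb3.le
    linarith [this]
  have e3 : κ * ((2 / (L : ℝ) ^ 3) ^ ((1 : ℝ) / 3) * β ^ (-(1 : ℝ) / 3)) * uniformFloorConst L = κ' * β ^ (-(1 : ℝ) / 3) := by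
    rw [hκ']; ring
  rw [e3]
  linarith

/-! ## §5 COARSE-UPPER(L) from V(L) and I₁(L) at polynomial scales -/

/-- ★★★ **COARSE-UPPER(L) from VALLEY GAIN and one-orbit INNER NO-INTRUDER at the polynomial scales `β^{−p}`, `0 < p < 1/3`** (conclusion =
VERBATIM the body of KTR's `CoarseNoIntruderAt L`; `L = 2` is stub 3b′). [cite: Luscher1983, §3] [cite: LuscherMunster1984, §2] -/
theorem coarseNoIntruderAt_of_valley_oneOrbit_pow {p : ℝ} (hp0 : 0 < p) (hp : p < 1 / 3)
    (hV : ValleyGainAt L (powScale p) (powScale p)) (hI : InnerNoIntruderOneOrbitAt L (powScale p)) :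
    ∀ k : ℕ, ∀ d : ℝ, d < levelGap k → ∃ lam0 : ℝ, 0 < lam0 ∧ ∀ lam : ℝ, 0 < lam → lam ≤ lam0 →
      ∀ β : ℝ, InFemtoWindow lam β L →
        levelValue su2Rep L β k ≤ Real.exp (-(d * luscherLambda β L) / L) * levelValue su2Rep L β 0 := by
  have hL : (0 : ℝ) < L := by exact_mod_cast Nat.pos_of_ne_zero (NeZero.ne L)
  exact coarseNoIntruderAt_of_valley_inner (scalesAdmissible_powScale hp0 hp) hV
    (innerNoIntruderAt_of_oneOrbit (fun β => powScale_pos p β) (powScale_eventually_le hp0 (by positivity)) hI)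

end Summit.QuantumFields.YangMills.Theorems.FemtoTransferGap

end
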